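import Summits.BirchSwinnertonDyer.BirchSwinnertonDyer.Theses.ByReductionTypeAtTwo
import Summits.BirchSwinnertonDyer.BirchSwinnertonDyer.Theorems.ByReductionTypeAtTwoAdditivePotGoodKatoHalf
import HarnessLib

/-!
# K4 crux `AdditiveRankZeroAtTwo` (item 19098), split v2.2 (gate5, 2026-08-28T16:12:45Z): the glue item
# `AdditiveRankZeroAtTwoSplitGlue` (stmt-BirchSwinnertonDyer-22620) MODULO the sibling crux `MultiplicativeRankZeroAtTwo`

Cell `bsd-2adic`, seat `bsd-2adic-addL2x` GEN 12. HONEST FRAMING: a `--supports 22620 --as helper` file; it does NOT close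
the glue item. BSD is not proved by any of this. Theorems only.

WHY NOT `_holds`. The planner's execution package v2.2 (`plan/split-19098/v22/glue-19098-v2_2.lean`, render mock rc 0) typed
the glue as `AdditivePrintedInputsAtTwo → MultiplicativeRankZeroAtTwo → C1″ → C2″ → C3″ → C4″ → AdditiveRankZeroAtTwo` — one
application of addL2x GEN 11 p627985 `AddKatoTwo.additiveRankZeroAtTwo_of_residual_v4`, whose binder `hMult` is the SIBLING crux
`MultiplicativeRankZeroAtTwo` (the potentially multiplicative additive curves descend from BSD₂ of their semistabilising
twist, which is multiplicative at `2`). The RENDERED route decl (rev 23) reads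
`FineSelmerConjAAtTwoAdditivePotGood → AdditivePotGoodReducibleRestAtTwo → AdditivePotGoodLowerHalfAtTwo → AdditivePotMultOverKAtTwo
→ AdditivePrintedInputsAtTwo → AdditiveRankZeroAtTwo` — the children only, WITHOUT the sibling (its docstring still lists it).
As rendered, the glue is `_v4` minus `hMult`; this file proves exactly «sibling ⟹ glue», i.e. the glue item BY NAME from
`MultiplicativeRankZeroAtTwo` BY NAME — so 22620 closes the moment either the renderer restores the sibling hypothesis (then
`_holds` is this proof with `hMult` introduced) or `MultiplicativeRankZeroAtTwo` is proved (K4 items 19922/19923 + glue 19924).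
-/

set_option autoImplicit false
set_option linter.dupNamespace false

noncomputable section

open scoped Classical

namespace Summit.BirchSwinnertonDyer.BirchSwinnertonDyer.Theorems

open Summit.BirchSwinnertonDyer.BirchSwinnertonDyer.Theses.ByReductionTypeAtTwo

/-- **The v2.2 glue of 19098 from the sibling `MultiplicativeRankZeroAtTwo` BY NAME**: `MultiplicativeRankZeroAtTwo →
AdditiveRankZeroAtTwoSplitGlue`, i.e. sibling + C1″ + C2″ + C3″ + C4″ + C5‴ ⟹ `AdditiveRankZeroAtTwo`, by ONE application of
p627985 `AddKatoTwo.additiveRankZeroAtTwo_of_residual_v4` (the Kato half on the whole additive potentially-good class is proved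
inside). [cite: Kato2004, Thm. 12.5, §13, Thm. 14.5, Prop. 14.16 (2)] [cite: Milne1972ArithmeticAV, Thm. 1] -/
theorem additiveRankZeroAtTwoSplitGlue_of_multiplicativeRankZeroAtTwo (hMult : MultiplicativeRankZeroAtTwo) :
    AdditiveRankZeroAtTwoSplitGlue := by
  rintro h1 h2 h3 h4 ⟨hGZK, hrat, hMilneC, hHL, hLim2, hFW, hSharp, hmodN, hin, hCassels, hCT⟩
  exact Summit.BirchSwinnertonDyer.BirchSwinnertonDyer.Theorems.AddKatoTwo.additiveRankZeroAtTwo_of_residual_v4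
    hGZK hrat hmodN hMilneC hHL hLim2 hFW hCassels hCT hSharp hin hMult h1 h2 h3 h4

end Summit.BirchSwinnertonDyer.BirchSwinnertonDyer.Theorems

end
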